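import Mathlib
import Summits.NavierStokesRegularity.NavierStokesRegularity.Theorems.TypeIQuarterGateScarEnvelopeTypeISatelliteTowerKeyholeTransfer

/-!
# Satellite tower for crux `ScarEnvelopeTypeI` (stmt-NavierStokesRegularity-23843) — ROUND-47 Part K, K3–K5: the crux-1589 lineage's removals THROUGH A KEYHOLE (`smallHullRemoval`, `stub_frFastRecurrenceRemoval`, `stub_frEpochRemoval` with the closeness measured on any keyhole; the rooted (ρ)-enemy recurs SLOWLY through every keyhole)

Module (27b) of the landing form (plate l.1166–1255): K3 ★★★ `abTower_keyhole_smallHullRemoval` (= `Theorems.smallHullRemoval` with the whole-orbit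
closeness measured on any keyhole); K4 `abTower_keyhole_fastRecurrenceRemoval` (= `stub_frFastRecurrenceRemoval` through a keyhole); K4′
`RootObj.slowRecurrence_keyhole` (the rooted enemy (ρ) recurs SLOWLY through every keyhole); K5 `abTower_keyhole_epochRemoval` (= `stub_frEpochRemoval`
through a keyhole).  Inputs BY NAME from the LANDED crux-1589 lineage modules `Theorems.SqueezeCycleRecurrentLiouvilleSmallHullRemoval`,
`…RecurrentProfilesRecurrentLiouvilleFrFastRecurrenceRemoval`, `…FrEpochRemoval` and ROUND-44 Z1 `ABTower.prClass` (`…SatelliteTowerHullJunction`).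

PROVENANCE: declaration texts VERBATIM from the HOME artefact of the instrument seat nsreg-p3 g29 (cell `pub/ns-regularity-ideate`):
`round-47/partK47.lean` (sha16 `868e779d1667521b`; = the ROUND-46 v1.1 plate text byte-identically + `section Keyhole`, plate l.977–1256, 9 declarations;
written against the TREE over the landed census modules and the crux-1589 lineage modules `Theorems.SqueezeCycleRecurrentLiouvilleSmallHullRemoval`,
`…RecurrentProfilesRecurrentLiouvilleFrFastRecurrenceRemoval`, `…FrEpochRemoval`; memo `round-47/ROUND-47.md` 8baeb760d925f076), scored by referee ref3
(`SCORE-p3-ROUND-47-0828.md`); the author cannot write under `Theorems/` (`perm.theorems-prover-only`); landed by the prover ns-es-p1 g6 as landing hand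
of record (director-ns DIRECTOR-NS #237 (3)) following the landing form ROUND-47.md §7 (27a)(27b); the ROUND-46 part of the plate is NOT re-landed (it is
the tree's `…SatelliteTowerUniqueContinuation/…NoExactReturn/…DefectFloor`, p673498/p673555/p673853); the artefact's `#guard_msgs … #print axioms`
certificates are not landed.  `--supports stmt-NavierStokesRegularity-23843 --as helper`.

HONEST FRAMING: qualitative «three-cylinder» / keyhole INSTRUMENT theorems about HYPOTHETICAL Type-I zoom limits (Albritton–Barker objects of the census of
crux `TypeIQuarterGate.ScarEnvelopeTypeI`, item 23843; classes possibly empty).  WHERE NS ENTERS = the identity theorem E2′ (space–time analyticity,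
LR 2016 Thm 9.12, BY NAME) + CKN/A–B compactness (`abTower_seqCompact`); mechanism = Tikhonov «injective + compact ⇒ uniformly continuous inverse», KNOWN;
ALL moduli δ/η/θ are INEFFECTIVE (contradiction + compactness).  Movement 0 on anything open: item 23843, route TypeIQuarterGate, crux 1589
`RecurrentLiouville`, (ρ)/(θ′)/(υ), the DSS cells (τ)(κ) at coarse ratio, N0 and Navier–Stokes regularity are all OPEN — NS regularity is NOT proved
here; no decl is an edge or a proof-of-item (plate audit: orphan 51 / closes 0).  Nearest print (memo §6): Lin–Wang quantitative three-cylinder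
uniqueness for the non-stationary Stokes system (the EFFECTIVE spatial leg, not used here); in-tree neighbour: the typed Prop `AnalyticPropagationOfSmallness`.
-/

noncomputable section

-- the summit-side namespace repeats a component by design (single-conjunct summit, D-0017)
set_option linter.dupNamespace false

open MeasureTheory Set Metric Filter Topology Function
open scoped ENNReal NNReal
open Literature.Analysis.FluidPDE

namespace Summit.NavierStokesRegularity.NavierStokesRegularity.Cruxes.ScarEnvelopeTypeI.ZoomDictionary

section Keyhole

/-- ★★★ **K3. KEYHOLE SMALL-HULL REMOVAL** (the crux-1589 lineage's `smallHullRemoval`, watched through a keyhole):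
there is `δ = δ(M, I, O) > 0` such that an A–B object of the class at level `≤ I` whose WHOLE scaling orbit stays
`δ`-close to it in `L³(O)` — `O` any open nonempty keyhole `⋐ Q_{R₀}(0,0)` — is regular at the root. -/
theorem abTower_keyhole_smallHullRemoval (M : ℝ) {I : ℝ≥0∞} (hI : I < ⊤)
    {O : Set (ℝ × (EuclideanSpace ℝ (Fin 3)))} (hO : IsOpen O) (hne : O.Nonempty) {R₀ : ℝ} (hR₀ : 0 < R₀)
    (hOs : O ⊆ parabolicCylinder R₀ (0 : ℝ × (EuclideanSpace ℝ (Fin 3)))) :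
    ∃ δ : ℝ≥0∞, 0 < δ ∧
      ∀ (U : ℝ → (EuclideanSpace ℝ (Fin 3)) → (EuclideanSpace ℝ (Fin 3)))
        (P : ℝ → (EuclideanSpace ℝ (Fin 3)) → ℝ)
        (H : ℝ → (EuclideanSpace ℝ (Fin 3)) → (EuclideanSpace ℝ (Fin 3)) →L[ℝ] (EuclideanSpace ℝ (Fin 3))),
        ABTower M U P H →
          typeIBound (Iio (0 : ℝ) ×ˢ (univ : Set (EuclideanSpace ℝ (Fin 3)))) U P H ≤ I →
          (∀ σ : ℝ, eLpNorm (uncurry (nsRescale (Real.exp σ) U) - uncurry U) 3 (volume.restrict O) ≤ δ) →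
          RegPt U 0 := by
  obtain ⟨δ₁, hδ₁, hrem⟩ := Theorems.smallHullRemoval M I hI
  obtain ⟨δ, hδ, htr⟩ := abTower_orbit_smallness_transfer M hI hO hne hR₀ hOs (ENNReal.ofReal_pos.2 hδ₁)
  refine ⟨δ, hδ, fun U P H hT hl horb => ?_⟩
  obtain ⟨hsw, hwg, -, hdec⟩ := hT.prClass
  by_contra h0
  refine hrem U P H hsw hwg hl hdec (fun σ => ?_) ?_
  · exact (htr U P H hT hl (Real.exp σ) (Real.exp_pos σ) (horb σ)).le
  · rw [prod_zero_eq]; exact isBackwardSingularPoint_of_not_regPt h0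

/-- ★★ **K4. KEYHOLE FAST-RECURRENCE REMOVAL** (the lineage's `stub_frFastRecurrenceRemoval` through a keyhole):
there are `L = L(M, I) > 0` and `δ = δ(M, I, O) > 0` such that an A–B object at level `≤ I` whose orbit returns
`δ`-close to it in `L³(O)` within EVERY log-scale window `[a, a + L]` is regular at the root.  Contrapositive:
the recurrent enemy (ρ) recurs SLOWLY even when watched through any keyhole. -/
theorem abTower_keyhole_fastRecurrenceRemoval (M : ℝ) {I : ℝ≥0∞} (hI : I < ⊤)
    {O : Set (ℝ × (EuclideanSpace ℝ (Fin 3)))} (hO : IsOpen O) (hne : O.Nonempty) {R₀ : ℝ} (hR₀ : 0 < R₀)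
    (hOs : O ⊆ parabolicCylinder R₀ (0 : ℝ × (EuclideanSpace ℝ (Fin 3)))) :
    ∃ L : ℝ, 0 < L ∧ ∃ δ : ℝ≥0∞, 0 < δ ∧
      ∀ (U : ℝ → (EuclideanSpace ℝ (Fin 3)) → (EuclideanSpace ℝ (Fin 3)))
        (P : ℝ → (EuclideanSpace ℝ (Fin 3)) → ℝ)
        (H : ℝ → (EuclideanSpace ℝ (Fin 3)) → (EuclideanSpace ℝ (Fin 3)) →L[ℝ] (EuclideanSpace ℝ (Fin 3))),
        ABTower M U P H →
          typeIBound (Iio (0 : ℝ) ×ˢ (univ : Set (EuclideanSpace ℝ (Fin 3)))) U P H ≤ I →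
          (∀ a : ℝ, ∃ σ ∈ Icc a (a + L),
            eLpNorm (uncurry (nsRescale (Real.exp σ) U) - uncurry U) 3 (volume.restrict O) ≤ δ) →
          RegPt U 0 := by
  obtain ⟨L, hL, δ₁, hδ₁, hrem⟩ := Theorems.stub_frFastRecurrenceRemoval M I hI
  obtain ⟨δ, hδ, htr⟩ := abTower_orbit_smallness_transfer M hI hO hne hR₀ hOs (ENNReal.ofReal_pos.2 hδ₁)
  refine ⟨L, hL, δ, hδ, fun U P H hT hl hret => ?_⟩
  obtain ⟨hsw, hwg, -, hdec⟩ := hT.prClass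
  by_contra h0
  refine hrem U P H hsw hwg hl hdec (fun a => ?_) ?_
  · obtain ⟨σ, hσ, hσO⟩ := hret a
    exact ⟨σ, hσ, (htr U P H hT hl (Real.exp σ) (Real.exp_pos σ) hσO).le⟩
  · rw [prod_zero_eq]; exact isBackwardSingularPoint_of_not_regPt h0

/-- ★★ **K4′. Census reading: the rooted enemy recurs slowly through every keyhole.**  For every rooted A–B object at
level `≤ I` there is a log-scale window `[a, a + L(M,I)]` during which its orbit stays `δ(M, I, O)`-FAR from it in
`L³(O)`. -/
theorem RootObj.slowRecurrence_keyhole (M : ℝ) {I : ℝ≥0∞} (hI : I < ⊤)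
    {O : Set (ℝ × (EuclideanSpace ℝ (Fin 3)))} (hO : IsOpen O) (hne : O.Nonempty) {R₀ : ℝ} (hR₀ : 0 < R₀)
    (hOs : O ⊆ parabolicCylinder R₀ (0 : ℝ × (EuclideanSpace ℝ (Fin 3)))) :
    ∃ L : ℝ, 0 < L ∧ ∃ δ : ℝ≥0∞, 0 < δ ∧ ∀ n : TNode, RootObj M n →
      typeIBound (Iio (0 : ℝ) ×ˢ (univ : Set (EuclideanSpace ℝ (Fin 3)))) n.U n.P n.H ≤ I →
        ∃ a : ℝ, ∀ σ ∈ Icc a (a + L),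
          δ < eLpNorm (uncurry (nsRescale (Real.exp σ) n.U) - uncurry n.U) 3 (volume.restrict O) := by
  obtain ⟨L, hL, δ, hδ, h⟩ := abTower_keyhole_fastRecurrenceRemoval M hI hO hne hR₀ hOs
  refine ⟨L, hL, δ, hδ, fun n hn hIn => ?_⟩
  by_contra hcon
  push Not at hcon
  exact hn.2 (h n.U n.P n.H hn.1 hIn hcon)

/-- ★★ **K5. KEYHOLE EPOCH REMOVAL** (the lineage's `stub_frEpochRemoval` through a keyhole): there are
`W = W(M, I) > 0` and `θ = θ(M, I, O) > 0` such that an A–B object at level `≤ I` with a NEAR-STATIONARY EPOCH seen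
through the keyhole — `‖U_{e^s} − U‖_{L³(O)} ≤ θ` for all `s ∈ [0, W]` — is regular at the root. -/
theorem abTower_keyhole_epochRemoval (M : ℝ) {I : ℝ≥0∞} (hI : I < ⊤)
    {O : Set (ℝ × (EuclideanSpace ℝ (Fin 3)))} (hO : IsOpen O) (hne : O.Nonempty) {R₀ : ℝ} (hR₀ : 0 < R₀)
    (hOs : O ⊆ parabolicCylinder R₀ (0 : ℝ × (EuclideanSpace ℝ (Fin 3)))) :
    ∃ W : ℝ, 0 < W ∧ ∃ θ : ℝ≥0∞, 0 < θ ∧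
      ∀ (U : ℝ → (EuclideanSpace ℝ (Fin 3)) → (EuclideanSpace ℝ (Fin 3)))
        (P : ℝ → (EuclideanSpace ℝ (Fin 3)) → ℝ)
        (H : ℝ → (EuclideanSpace ℝ (Fin 3)) → (EuclideanSpace ℝ (Fin 3)) →L[ℝ] (EuclideanSpace ℝ (Fin 3))),
        ABTower M U P H →
          typeIBound (Iio (0 : ℝ) ×ˢ (univ : Set (EuclideanSpace ℝ (Fin 3)))) U P H ≤ I →
          (∀ s ∈ Icc (0 : ℝ) W,
            eLpNorm (uncurry (nsRescale (Real.exp s) U) - uncurry U) 3 (volume.restrict O) ≤ θ) →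
          RegPt U 0 := by
  obtain ⟨W, hW, θ₁, hθ₁, hrem⟩ := Theorems.stub_frEpochRemoval M I hI
  obtain ⟨θ, hθ, htr⟩ := abTower_orbit_smallness_transfer M hI hO hne hR₀ hOs (ENNReal.ofReal_pos.2 hθ₁)
  refine ⟨W, hW, θ, hθ, fun U P H hT hl hep => ?_⟩
  obtain ⟨hsw, hwg, -, hdec⟩ := hT.prClass
  by_contra h0
  refine hrem U P H hsw hwg hl hdec (fun s hs => ?_) ?_
  · exact (htr U P H hT hl (Real.exp s) (Real.exp_pos s) (hep s hs)).le
  · rw [prod_zero_eq]; exact isBackwardSingularPoint_of_not_regPt h0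

end Keyhole

end Summit.NavierStokesRegularity.NavierStokesRegularity.Cruxes.ScarEnvelopeTypeI.ZoomDictionary

end
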